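import Literature.Analysis.FluidPDE.ClassicalSobolevUniqueness
import Literature.Analysis.FluidPDE.CheskidovShvydkoyRegularProofs
import Literature.Analysis.FluidPDE.NSVorticityBKMContinuation
import HarnessLib

/-!
# Continuation of classical Navier–Stokes solutions in the Beale–Kato–Majda class from a uniform
# `H¹` bound

Analysis/FluidPDE proof file (theorems only), a brick of the discharge of
`Literature.Analysis.FluidPDE.constantin_fefferman` (`NSVorticity.lean`): the classical fact that
for `ν > 0` the enstrophy controls the regularity of a smooth finite-energy solution — **if
`‖u(t)‖²_{L²} + ‖∇u(t)‖²_{L²}` stays bounded on `[0, T)` then the solution continues in the class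
`⋂ₛ L^∞([0, T]; Hˢ)` past `T`** (`hasSobolevExtensionPast_of_uniform_H1_bound`). This is how
Constantin–Fefferman conclude (Indiana Univ. Math. J. 42 (1993), end of the proof of the Theorem:
the enstrophy bound implies regularity; Lemarié-Rieusset 2016, proof of Thm. 11.7: "it is enough
to show that `u` does not blow up in `H¹`").

## Proof (restart-and-glue, all ingredients proved in the tree)

With `c` the lifespan constant of Tao's local existence theorem for smooth `H^∞` data
(`tao2011_smooth_local_existence_holds`, Tao 2013, Thm. 5.4 (ii)+(iv): a classical solution on
`[0, τ]` with all Sobolev norms bounded as soon as `‖u₀‖⁴_{H¹} τ ≤ c ν³`), put `τ = cν³/(A² + 1)`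
and restart from the slice `u(s)`, `s = max(0, T − τ/2)`: the local solution `v` agrees with
`u(· + s)` on `[0, T − s)` by uniqueness in the class (`MajdaBertozzi2002_uniquenessSobolev_holds`,
Majda–Bertozzi 2002, Cor. 3.1) and lives up to `τ > T − s`; `HasSobolevExtensionPast.of_translate`
(`NSVorticityBKMContinuation.lean`) glues. This is `hasSobolevExtensionPast_of_H3_bound_of_parts`
(ibid.) with the `H³` local theory replaced by the `H¹` one.

## Mathlib / tree search

`lean search 'hasSobolevExtensionPast_of'`: `…_of_H3_bound_of_parts`, `…_of_hasBoundedSobolevNormsOn_of_parts`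
(`H³`/all seminorms); `TaoLocalisationContinuation.hasBoundedSobolevNormsOn_restart` and
`TaoBoundedEnstrophyContinuation` restart on *closed* slabs `[0, T]`; nothing from a uniform `H¹`
bound on `[0, T)` to `HasSobolevExtensionPast`.

## References

* P. Constantin, C. Fefferman, Indiana Univ. Math. J. 42 (1993), 775–789, §2 (end of proof).
  [ConstantinFeffermanIndiana1993]
* P. G. Lemarié-Rieusset, *The Navier–Stokes Problem in the 21st Century* (2016), Thm. 11.7
  (proof, PDF p. 369). [LemarieRieusset2016]
* T. Tao, Anal. PDE 6 (2013) = arXiv:1108.1165, Thm. 5.4 (ii)+(iv). [Tao2011]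
* A. J. Majda, A. L. Bertozzi, *Vorticity and Incompressible Flow* (2002), Cor. 3.1–3.2.
  [MajdaBertozzi2002]
-/

noncomputable section

open MeasureTheory Set Function Filter
open scoped ENNReal NNReal ContDiff

namespace Literature.Analysis.FluidPDE

/-- **Continuation in the Beale–Kato–Majda class from a uniform `H¹` bound** (the classical
"enstrophy controls regularity" principle for `ν > 0`, as used at the end of the proof of
Constantin–Fefferman's theorem and in Lemarié-Rieusset 2016, proof of Thm. 11.7). Let `ν > 0`,
`T > 0`, and let `(u, p)` be a classical unforced Navier–Stokes solution on `ℝ³ × [0, T)` with all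
`L²` Sobolev seminorms bounded on every `[0, T'']`, `T'' < T`. If
`‖u(t)‖²_{L²} + ‖∇u(t)‖²_{L²} ≤ A` for all `t ∈ [0, T)`, then `u` continues in the class past `T`
(`HasSobolevExtensionPast ν u T`). Proof: restart at `s = max(0, T − τ/2)` with Tao's `H¹` lifespan
`τ = cν³/(A²+1)` (`tao2011_smooth_local_existence_holds`), identify by
`MajdaBertozzi2002_uniquenessSobolev_holds`, glue by `HasSobolevExtensionPast.of_translate`. [cite: LemarieRieusset2016, Thm. 11.7 (proof, PDF p. 369); Tao2011, Thm. 5.4 (ii)+(iv)] -/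
theorem hasSobolevExtensionPast_of_uniform_H1_bound {ν T : ℝ} (hν : 0 < ν) (hT : 0 < T)
    {u : ℝ → EuclideanSpace ℝ (Fin 3) → EuclideanSpace ℝ (Fin 3)}
    {p : ℝ → EuclideanSpace ℝ (Fin 3) → ℝ}
    (hsol : IsClassicalNSSolutionOn (Ico 0 T) ν 0 u p)
    (hreg : ∀ T'' < T, HasBoundedSobolevNormsOn (Icc 0 T'') u) {A : ℝ} (hA0 : 0 ≤ A)
    (hA : ∀ t ∈ Ico 0 T,
      (∫⁻ x, ‖u t x‖ₑ ^ 2) + (∫⁻ x, ENNReal.ofReal (frobeniusNormSq (fderiv ℝ (u t) x))) ≤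
        ENNReal.ofReal A) :
    HasSobolevExtensionPast ν u T := by
  obtain ⟨c, hc, hloc⟩ := tao2011_smooth_local_existence_holds
  -- the lifespan and the restart time
  set τ : ℝ := c * ν ^ 3 / (A ^ 2 + 1) with hτ
  have hτpos : 0 < τ := by positivity
  set s : ℝ := max 0 (T - τ / 2) with hs
  have hs0 : 0 ≤ s := le_max_left _ _
  have hsT : s < T := max_lt hT (by linarith)
  have hTs : T - s ≤ τ / 2 := by
    have : T - τ / 2 ≤ s := le_max_right _ _
    linarith
  have hsS : s ∈ Ico 0 T := ⟨hs0, hsT⟩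
  have hregs : HasBoundedSobolevNormsOn (Icc 0 s) u := hreg s hsT
  -- the datum `u s`
  have hus : ContDiff ℝ ∞ (u s) := hsol.contDiff_velocity hsS
  have hdiv : VectorCalculus.IsDivFree (u s) := hsol.divFree s hsS
  have hHk : ∀ n : ℕ, ∫⁻ x, ‖iteratedFDeriv ℝ n (u s) x‖ₑ ^ 2 < ⊤ := fun n => by
    obtain ⟨C, hC⟩ := hregs n
    exact (hC s ⟨hs0, le_rfl⟩).trans_lt ENNReal.coe_lt_top
  have hsmall : A ^ 2 * τ ≤ c * ν ^ 3 :=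
    calc A ^ 2 * τ ≤ (A ^ 2 + 1) * τ := by gcongr; linarith
      _ = c * ν ^ 3 := by rw [hτ]; field_simp
  -- Tao's local classical solution `v` on `[0, τ]` from `u s`
  obtain ⟨v, q, hv, hv0, hvB, -, -, -⟩ := hloc hν hτpos hus hdiv hHk hA0 (hA s hsS) hsmall
  -- uniqueness on `[0, T - s)`: `v = u (· + s)`
  have huniq : ∀ t ∈ Ico 0 (T - s), u (t + s) = v t := by
    intro t ht
    obtain ⟨ht0, htT⟩ := ht
    set S : ℝ := (t + (T - s)) / 2 with hS
    have htS : t ≤ S := by linarith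
    have hS' : S < T - s := by linarith
    have hSτ : S ≤ τ := by linarith
    have hS0 : 0 < S := by linarith
    have h1 : IsClassicalNSSolutionOn (Icc 0 S) ν 0 (fun r => u (r + s)) (fun r => p (r + s)) :=
      (hsol.translate_Ico_zero hs0).mono (Icc_subset_Ico_right hS') (uniqueDiffOn_Icc hS0)
    have h2 : IsClassicalNSSolutionOn (Icc 0 S) ν 0 v q :=
      hv.mono (Icc_subset_Icc_right hSτ) (uniqueDiffOn_Icc hS0)
    have hB1 : HasBoundedSobolevNormsOn (Icc 0 S) (fun r => u (r + s)) := by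
      have h := hreg (S + s) (by linarith)
      intro n
      obtain ⟨C, hC⟩ := h n
      exact ⟨C, fun r hr => hC (r + s) ⟨by linarith [hr.1], by linarith [hr.2]⟩⟩
    have hB2 : HasBoundedSobolevNormsOn (Icc 0 S) v := hvB.mono (Icc_subset_Icc_right hSτ)
    have h0 : (fun r => u (r + s)) 0 = v 0 := by simp only [zero_add, hv0]
    exact MajdaBertozzi2002_uniquenessSobolev_holds hν.le hS0 h1 h2 hB1 hB2 h0 t ⟨ht0, htS⟩
  -- `v` continues the translate past `T - s`
  have hext : HasSobolevExtensionPast ν (fun t => u (t + s)) (T - s) :=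
    ⟨τ, by linarith, v, q, hv.mono Ico_subset_Icc_self (uniqueDiffOn_Ico 0 τ),
      hvB.mono (Icc_subset_Icc_right (by linarith)), fun t ht => (huniq t ht).symm⟩
  exact HasSobolevExtensionPast.of_translate hsol hregs hs0 hsT hext

end Literature.Analysis.FluidPDE

end
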